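import Summits.Ventures.GridStability.Lyapunov.StructurePreservingRoa
import Summits.Ventures.GridStability.Lyapunov.StructurePreservingFaceBound
import HarnessLib

/-!
# GridStability/Lyapunov/StructurePreservingFaceRoa — the PER-FACE sublevel theorem for the
# structure-preserving model: region of attraction of the synchronous equilibrium for every level `c` below
# the energy on the `2|E|` faces of the angle window (Vu–Turitsyn's `V_min` shape)

Cell `gridfusion`, line G2-SCALE (BRIEF-GRIDFUSION-G2SCALE §1 question Q1, level piece); object T1 of the
lead's TYPING ORDER (cell STATUS §10, 2026-08-28) = support P1 of idea card «idea-3 /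
face-local-level-certificates» (HOME/IDEAS-G2.md, REV 3, card sha16 cde2b5ff4cd8b76a; crit-1's readings
STATUS l.10127 and the CORRECTION OF SUBSTANCE l.10179: faces `σ_e = ±π/2` of the WINDOW OF RECORD
`StructurePreservingPhase.window`); typed by gridfusion-lit-4 (g14).  0 kit, 0 named facts, no `decide`.

THE CARD'S MOVE 1 (face split): lyap-1's `sublevel_subset_regionOfAttraction` (`StructurePreservingRoa.lean`)
takes the level in the UNIFORM form `c < levelBound θ β = g(θ)·β·(π/2 − θ)²/4`, used only through model-2's
`branch_abs_lt_of_energy_le` (`V ≤ c` keeps every coupled branch STRICTLY inside the window, so the sublevel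
piece over the CLOSED window lies in the OPEN one — compactness).  The same conclusion holds as soon as `c` is
below the energy at every point of the closed window (on the constraint set) having a TIGHT coupled branch
`|δᵢ − δⱼ| = π/2` («{V ≤ c} ∩ W̄ misses ∂W iff for each of the 2|E| faces F_e^± … inf_F V > c», card §
Mechanism) — in particular as soon as `c < m i j` for a face bound `m` of the POTENTIAL
(`StructurePreservingFaceBound.IsFaceBound`; kinetic energy `≥ 0`).

## Contents (all PROVED; MODELLED column — statements about MODEL MV-3, model-2's `Params`)
* §1 the FACE-LEVEL hypothesis in its weakest form (crit-1 l.10179): `IsBelowFaces p δ₀ c` := «`c < V(x)` for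
  every `x` of the closed window ∩ constraint set with a tight coupled branch»; `IsFaceBound.isBelowFaces`
  (`c < m i j` on coupled pairs ⇒ `IsBelowFaces c`); `isBelowFaces_of_lt_levelBound` (the uniform threshold);
  `branch_abs_lt_of_isBelowFaces` (per-face exit lemma) and `isCompact_sublevel_of_isBelowFaces` (lyap-1's
  compactness proof with the exit step swapped; bounded by model-2's `state_bound_of_energy_le`).
* §2 **`sublevel_subset_regionOfAttraction_of_isBelowFaces`** — lyap-1's hypothesis list with
  `hc : c < levelBound θ β` REPLACED by `hc : IsBelowFaces p δ₀ c`, SAME conclusion, proof = the tree's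
  Barbashin–Krasovskii theorem `Literature.Analysis.ODE.sublevel_subset_regionOfAttraction_of_noCompleteTrajectory`
  with the new compactness lemma; the emitter's form **`sublevel_subset_regionOfAttraction_of_faceBound`**
  (`IsFaceBound p δ₀ m`, `∀ i j, bᵢⱼ ≠ 0 → c < m i j`); the COROLLARY «theorem of record = this theorem ∘ the uniform
  certificate» (crit-1 s1 / lead §11 (K3)) is `isBelowFaces_of_lt_levelBound` fed to it (not re-declared: the gate's
  dedup rule identifies the composite with lyap-1's declaration); and the printed-vocabulary sentence `tendsto_of_isSolution_of_faceBound` (mirrors lyap-1's `tendsto_of_isSolution`).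
`β`, `θ` survive only qualitatively (boundedness of the sublevel piece; uniqueness of the equilibrium on the
momentum level set, hypothesis (iii)); they no longer enter the level `c`.
THREE COLUMNS: no certificate here (an instance's `m i j` and `c` are Bench data, checked there); the card's
VALIDATED ratios (NE39 ×3.29, NETS68 ×14.7 over the uniform level) are the card's; MODELLED: MV-3 (constant `|V|` absorbed in `bᵢⱼ`); no
sentence here says a grid is stable.  Sources: [cite: BergenHill1981]; [cite: Padiyar2013, §3.2 eqs (3.11)–(3.15)];
[cite: VuTuritsyn2017, §IV-A] (face minima, `V_min`); [cite: RoucheHabetsLaloy1977, Ch. II Thm 1.3] via the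
Literature theorem.
-/

noncomputable section

open Set Filter Topology Real
open Summit.Ventures.GridStability.Models.StructurePreserving
open Summit.Ventures.GridStability.Models.StructurePreserving.Params

namespace Summit.Ventures.GridStability.Lyapunov.StructurePreserving

variable {n : ℕ}

/-! ### §1 The face-level hypothesis, the exit lemma and compactness -/

/-- **THE FACE-LEVEL HYPOTHESIS** (weakest form; crit-1's reading STATUS l.10179): the level `c` is BELOW THE
FACES of the window for the data `p` and the equilibrium `δ₀` when `c < V(x)` for every phase point `x` whose
angles lie in the CLOSED window (`|δₖ − δₗ| ≤ π/2` on coupled pairs), which lies on the constraint set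
(momentum leaf of `(δ₀, 0)`, zero pseudo-frequencies at load buses), and which has a TIGHT coupled branch
`|δᵢ − δⱼ| = π/2` — «c < min over faces e^± of the face infimum V_e^±».  MODELLED (MV-3).
[cite: VuTuritsyn2017, §IV-A] (the level `V_min`) -/
def IsBelowFaces (p : Params n) (δ₀ : Fin n → ℝ) (c : ℝ) : Prop :=
  ∀ x : (Fin n → ℝ) × (Fin n → ℝ), (∀ k l, p.b k l ≠ 0 → |x.1 k - x.1 l| ≤ π / 2) →
    x ∈ constraintSet p δ₀ → (∃ i j, p.b i j ≠ 0 ∧ |x.1 i - x.1 j| = π / 2) → c < phaseEnergy p δ₀ x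

/-- A smaller level is still below the faces. [folklore] -/
theorem IsBelowFaces.mono {p : Params n} {δ₀ : Fin n → ℝ} {c c' : ℝ} (h : IsBelowFaces p δ₀ c)
    (hc : c' ≤ c) : IsBelowFaces p δ₀ c' :=
  fun x hx hM ht => hc.trans_lt (h x hx hM ht)

/-- **FACE BOUNDS OF THE POTENTIAL PUT EVERY SMALLER LEVEL BELOW THE FACES**: if `m` is a face bound
(`IsFaceBound p δ₀ m`: `m i j ≤ W` on the face `δᵢ − δⱼ = π/2` of the closed window) and `c < m i j` on every
coupled ordered pair, then `c` is below the faces — at a tight branch `|δᵢ − δⱼ| = π/2` one of the faces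
`(i, j)`, `(j, i)` applies and `c < m ≤ W ≤ V` (kinetic energy `≥ 0`; well-formed symmetric data).
[cite: VuTuritsyn2017, §IV-A] with [Padiyar2013] §3.2 eq (3.11) -/
theorem IsFaceBound.isBelowFaces {p : Params n} (hp : p.WellFormed) {δ₀ : Fin n → ℝ}
    {m : Fin n → Fin n → ℝ} (hm : IsFaceBound p δ₀ m) {c : ℝ} (hcm : ∀ i j, p.b i j ≠ 0 → c < m i j) :
    IsBelowFaces p δ₀ c := by
  intro x hx _ ht
  obtain ⟨i, j, hij, heq⟩ := ht
  have hK0 : 0 ≤ p.kinetic x.2 := p.kinetic_nonneg (fun i hi => (hp.M_pos i hi).le) x.2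
  have hVW : p.potential δ₀ x.1 ≤ phaseEnergy p δ₀ x := by
    rw [phaseEnergy_apply]; unfold Params.energy; linarith
  rcases le_or_gt 0 (x.1 i - x.1 j) with hnn | hneg
  · -- the face `δᵢ − δⱼ = +π/2`
    have hface : x.1 i - x.1 j = π / 2 := by rw [← heq, abs_of_nonneg hnn]
    have := hm i j hij x.1 hx hface
    linarith [hcm i j hij]
  · -- the face `δⱼ − δᵢ = +π/2`, read on the ordered pair `(j, i)`
    have hji : p.b j i ≠ 0 := by rw [← hp.b_symm i j]; exact hij
    have hface : x.1 j - x.1 i = π / 2 := by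
      rw [← heq, abs_of_neg hneg]; ring
    have := hm j i hji x.1 hx hface
    linarith [hcm j i hji]

/-- **THE UNIFORM THRESHOLD PUTS THE LEVEL BELOW THE FACES**: under lyap-1's data (couplings `≥ β > 0` on
edges, equilibrium branch angles `≤ θ < π/2`), `c < levelBound θ β ⇒ IsBelowFaces p δ₀ c`
(`isFaceBound_levelBound`).  COROLLARY (crit-1 s1 / lead §11 (K3) «recovering CS14»): lyap-1's theorem of record
`sublevel_subset_regionOfAttraction` IS `sublevel_subset_regionOfAttraction_of_isBelowFaces` (§2) applied to this
lemma — same binders, same conclusion; it is not re-declared here (the gate's `dedup.landed` rule: one statement,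
one declaration). [cite: VuTuritsyn2017, §IV-A] -/
theorem isBelowFaces_of_lt_levelBound {p : Params n} (hp : p.WellFormed) (hb : ∀ i j, 0 ≤ p.b i j)
    {β : ℝ} (hβ : 0 < β) (hβb : ∀ i j, p.couplingGraph.Adj i j → β ≤ p.b i j)
    {δ₀ : Fin n → ℝ} {θ : ℝ} (hθ0 : 0 ≤ θ) (hθ : θ < π / 2)
    (h0 : ∀ i j, p.b i j ≠ 0 → |δ₀ i - δ₀ j| ≤ θ) {c : ℝ} (hc : c < levelBound θ β) :
    IsBelowFaces p δ₀ c :=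
  (isFaceBound_levelBound hp hb hβ hβb hθ0 hθ h0).isBelowFaces hp (fun _ _ _ => hc)

/-- **PER-FACE EXIT LEMMA** (card P1): a state of the CLOSED window on the constraint set with `V ≤ c`, `c`
below the faces, has every coupled branch STRICTLY inside the window (a tight branch would give
`V ≤ c < V`). [cite: VuTuritsyn2017, §IV-A] -/
theorem branch_abs_lt_of_isBelowFaces {p : Params n} {δ₀ : Fin n → ℝ} {c : ℝ} (hc : IsBelowFaces p δ₀ c)
    {x : (Fin n → ℝ) × (Fin n → ℝ)} (hP : ∀ i j, p.b i j ≠ 0 → |x.1 i - x.1 j| ≤ π / 2)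
    (hM : x ∈ constraintSet p δ₀) (hV : phaseEnergy p δ₀ x ≤ c) :
    ∀ i j, p.b i j ≠ 0 → |x.1 i - x.1 j| < π / 2 := by
  intro i j hij
  rcases (hP i j hij).lt_or_eq with hlt | heq
  · exact hlt
  · have := hc x hP hM ⟨i, j, hij, heq⟩
    linarith

/-- **COMPACTNESS OF THE SUBLEVEL PIECE FOR A LEVEL BELOW THE FACES.**  lyap-1's `isCompact_sublevel`
(`StructurePreservingSublevel.lean`) with the uniform exit step replaced by `branch_abs_lt_of_isBelowFaces`:
for well-formed data with susceptive couplings `bᵢⱼ ≥ 0`, `≥ β > 0` on the edges of a PRECONNECTED coupling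
graph, `n ≠ 0`, an equilibrium with branch angles `≤ θ < π/2`, and a level `c` below the faces, the piece
`{x ∈ window ∩ constraintSet | V x ≤ c}` is compact (closed: the open window may be replaced by the closed
one; bounded: model-2's `state_bound_of_energy_le` — which does not consume any level threshold, so `β`, `θ`
enter only qualitatively). [folklore] -/
theorem isCompact_sublevel_of_isBelowFaces {p : Params n} (hp : p.WellFormed) (hn : n ≠ 0)
    (hconn : p.couplingGraph.Preconnected) (hb : ∀ i j, 0 ≤ p.b i j) {β : ℝ} (hβ : 0 < β)
    (hβb : ∀ i j, p.couplingGraph.Adj i j → β ≤ p.b i j)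
    {δ₀ : Fin n → ℝ} {θ : ℝ} (hθ0 : 0 ≤ θ) (hθ : θ < π / 2)
    (h0 : ∀ i j, p.b i j ≠ 0 → |δ₀ i - δ₀ j| ≤ θ) {c : ℝ} (hc : IsBelowFaces p δ₀ c) :
    IsCompact {x | x ∈ window p ∩ constraintSet p δ₀ ∧ phaseEnergy p δ₀ x ≤ c} := by
  -- the same set with the CLOSED window
  set S' : Set ((Fin n → ℝ) × (Fin n → ℝ)) :=
    {x | (∀ i j, p.b i j ≠ 0 → |x.1 i - x.1 j| ≤ π / 2) ∧ x ∈ constraintSet p δ₀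
      ∧ phaseEnergy p δ₀ x ≤ c} with hS'
  have hSS' : {x | x ∈ window p ∩ constraintSet p δ₀ ∧ phaseEnergy p δ₀ x ≤ c} = S' := by
    ext x
    simp only [hS', mem_setOf_eq, mem_inter_iff, window]
    constructor
    · rintro ⟨⟨hw, hM⟩, hV⟩
      exact ⟨fun i j hij => (hw i j hij).le, hM, hV⟩
    · rintro ⟨hw, hM, hV⟩
      exact ⟨⟨branch_abs_lt_of_isBelowFaces hc hw hM hV, hM⟩, hV⟩
  rw [hSS']
  refine Metric.isCompact_of_isClosed_isBounded ?_ ?_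
  · -- closed
    have h1 : IsClosed {x : (Fin n → ℝ) × (Fin n → ℝ) |
        ∀ i j, p.b i j ≠ 0 → |x.1 i - x.1 j| ≤ π / 2} := by
      simp only [setOf_forall]
      refine isClosed_iInter fun i => isClosed_iInter fun j => isClosed_iInter fun _ => ?_
      exact isClosed_le (by fun_prop) continuous_const
    have h3 : IsClosed {x : (Fin n → ℝ) × (Fin n → ℝ) | phaseEnergy p δ₀ x ≤ c} :=
      isClosed_le (contDiff_phaseEnergy p δ₀).continuous continuous_const
    have h := h1.inter ((isClosed_constraintSet p δ₀).inter h3)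
    simpa only [hS', setOf_and, setOf_mem_eq] using h
  · -- bounded
    rw [isBounded_iff_forall_norm_le]
    set R : ℝ := (∑ j ∈ p.gen, p.M j * Real.sqrt (2 * c / p.M j)) / (∑ j, p.D j)
      + n * Real.sqrt (4 * c / ((1 - Real.sin θ) / (π / 2 - θ) * β)) with hR
    set B : ℝ := ∑ j ∈ p.gen, Real.sqrt (2 * c / p.M j) with hB
    refine ⟨R + ‖δ₀‖ + B, fun x hx => ?_⟩
    obtain ⟨hw, ⟨hL, hω0⟩, hV⟩ := hx
    have hst := state_bound_of_energy_le hp hn hconn hb hβ hβb hθ0 hθ h0 hw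
      (by simpa only [phaseEnergy_apply] using hV) hL
    have hBnn : 0 ≤ B := Finset.sum_nonneg fun j _ => Real.sqrt_nonneg _
    have hδ : ∀ i, |x.1 i| ≤ R + ‖δ₀‖ := fun i => by
      have h1 : |x.1 i - δ₀ i| ≤ R := by simpa only [hR] using hst.2 i
      have h2 : |δ₀ i| ≤ ‖δ₀‖ := by
        have := norm_le_pi_norm δ₀ i
        simpa only [Real.norm_eq_abs] using this
      calc |x.1 i| = |(x.1 i - δ₀ i) + δ₀ i| := by ring_nf
        _ ≤ |x.1 i - δ₀ i| + |δ₀ i| := abs_add_le _ _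
        _ ≤ R + ‖δ₀‖ := add_le_add h1 h2
    have hRnn : 0 ≤ R + ‖δ₀‖ := by
      obtain ⟨k, hk⟩ := Nat.exists_eq_succ_of_ne_zero hn
      subst hk
      exact (abs_nonneg _).trans (hδ 0)
    have hω : ∀ i, |x.2 i| ≤ B := fun i => by
      by_cases hi : i ∈ p.gen
      · exact (hst.1 i hi).trans (Finset.single_le_sum (f := fun j => Real.sqrt (2 * c / p.M j))
          (fun j _ => Real.sqrt_nonneg _) hi)
      · rw [hω0 i hi, abs_zero]
        exact hBnn
    have hn1 : ‖x.1‖ ≤ R + ‖δ₀‖ + B := by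
      refine (pi_norm_le_iff_of_nonneg (add_nonneg hRnn hBnn)).2 fun i => ?_
      rw [Real.norm_eq_abs]
      exact (hδ i).trans (le_add_of_nonneg_right hBnn)
    have hn2 : ‖x.2‖ ≤ R + ‖δ₀‖ + B := by
      refine (pi_norm_le_iff_of_nonneg (add_nonneg hRnn hBnn)).2 fun i => ?_
      rw [Real.norm_eq_abs]
      exact (hω i).trans (le_add_of_nonneg_left hRnn)
    rw [Prod.norm_def]
    exact max_le hn1 hn2

/-! ### §2 The per-face sublevel theorem -/

/-- **THE PER-FACE SUBLEVEL THEOREM, weakest form (region of attraction of the synchronous equilibrium of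
the structure-preserving model for every level below the faces of the window).**  DATA: as in lyap-1's
`sublevel_subset_regionOfAttraction` — well-formed structure-preserving data `p` on `n ≠ 0` buses, susceptive
couplings `bᵢⱼ ≥ 0` with `bᵢⱼ ≥ β > 0` on the edges of a PRECONNECTED coupling graph, a synchronous
equilibrium `δ₀` of the shifted model with branch angles `|δ₀ᵢ − δ₀ⱼ| ≤ θ < π/2` on coupled pairs — EXCEPT that
the level hypothesis `c < levelBound θ β` is REPLACED by `IsBelowFaces p δ₀ c` («c < V» at every point of the
closed window ∩ constraint set with a tight coupled branch; «c < min over faces e^± of the face infimum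
V_e^±», the Vu–Turitsyn `V_min` shape).  STATEMENT (VERBATIM lyap-1's): for every phase point `y = (δ, ω)` in
the window, on the constraint set and with `V(y) ≤ c`: (a) a global solution of `phaseField` starts at `y`;
(b) EVERY global solution from `y` keeps, for all `t ≥ 0`, the window, the constraints and `V ≤ c`, and tends
to `(δ₀, 0)`.  Proof: the tree's Barbashin–Krasovskii theorem with `isCompact_sublevel_of_isBelowFaces`;
everything else is lyap-1's.  Card idea-3 P1 / lead TYPING ORDER T1 / crit-1 l.10179.  No sentence here says
a grid is stable. [cite: VuTuritsyn2017, §IV-A] (level `V_min`); [cite: BergenHill1981] (energy function);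
[cite: RoucheHabetsLaloy1977, Ch. II Thm 1.3] (via the Literature theorem) -/
theorem sublevel_subset_regionOfAttraction_of_isBelowFaces {p : Params n} (hp : p.WellFormed) (hn : n ≠ 0)
    (hconn : p.couplingGraph.Preconnected) (hb : ∀ i j, 0 ≤ p.b i j) {β : ℝ} (hβ : 0 < β)
    (hβb : ∀ i j, p.couplingGraph.Adj i j → β ≤ p.b i j)
    {δ₀ : Fin n → ℝ} {θ : ℝ} (hθ0 : 0 ≤ θ) (hθ : θ < π / 2)
    (h0 : ∀ i j, p.b i j ≠ 0 → |δ₀ i - δ₀ j| ≤ θ) (hδ₀ : p.IsSyncEquilibrium δ₀)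
    {c : ℝ} (hc : IsBelowFaces p δ₀ c) {y : (Fin n → ℝ) × (Fin n → ℝ)}
    (hy : y ∈ window p ∩ constraintSet p δ₀ ∧ phaseEnergy p δ₀ y ≤ c) :
    (∃ X : ℝ → (Fin n → ℝ) × (Fin n → ℝ), X 0 = y ∧
      ∀ T : ℝ, ∀ t ∈ Icc 0 T, HasDerivWithinAt X (phaseField p (X t)) (Icc 0 T) t) ∧
    ∀ X : ℝ → (Fin n → ℝ) × (Fin n → ℝ), X 0 = y →
      (∀ T : ℝ, ∀ t ∈ Icc 0 T, HasDerivWithinAt X (phaseField p (X t)) (Icc 0 T) t) →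
      (∀ t, 0 ≤ t → X t ∈ window p ∩ constraintSet p δ₀ ∧ phaseEnergy p δ₀ (X t) ≤ c) ∧
        Tendsto X atTop (𝓝 (δ₀, 0)) :=
  Literature.Analysis.ODE.sublevel_subset_regionOfAttraction_of_noCompleteTrajectory
    (F := phaseField p) (V := phaseEnergy p δ₀) (V' := fderiv ℝ (phaseEnergy p δ₀))
    (G := window p) (M := constraintSet p δ₀) (isOpen_window p)
    (fun x _ => (((contDiff_phaseEnergy p δ₀).differentiable one_ne_zero) x).hasFDerivAt)
    (fun x _ => fderiv_phaseEnergy_phaseField_nonpos hp hδ₀ x)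
    (isCompact_sublevel_of_isBelowFaces hp hn hconn hb hβ hβb hθ0 hθ h0 hc) (contDiff_phaseField p)
    (fun _ hY0 hY hzero => eq_equilibrium_of_fderiv_eq_zero hp hn hconn hb hθ h0 hδ₀ hY0.1 hY hzero)
    (fun z hz _ X hX0 hX => mem_constraintSet_of_solution hp hn δ₀ hX (by rw [hX0]; exact hz.1.2))
    hy

/-- **THE PER-FACE SUBLEVEL THEOREM, emitter's form** (card P1: hypotheses `∀ i j, p.b i j ≠ 0 → c < m i j`
and `m` a face bound of the potential, `StructurePreservingFaceBound.IsFaceBound` — e.g. the closed forms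
`isFaceBound_closedForm` refined on a few faces by truncated-potential certificates `isFaceBound_of_truncated`);
same data and SAME conclusion as lyap-1's theorem. [cite: VuTuritsyn2017, §IV-A]; [cite: BergenHill1981] -/
theorem sublevel_subset_regionOfAttraction_of_faceBound {p : Params n} (hp : p.WellFormed) (hn : n ≠ 0)
    (hconn : p.couplingGraph.Preconnected) (hb : ∀ i j, 0 ≤ p.b i j) {β : ℝ} (hβ : 0 < β)
    (hβb : ∀ i j, p.couplingGraph.Adj i j → β ≤ p.b i j)
    {δ₀ : Fin n → ℝ} {θ : ℝ} (hθ0 : 0 ≤ θ) (hθ : θ < π / 2)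
    (h0 : ∀ i j, p.b i j ≠ 0 → |δ₀ i - δ₀ j| ≤ θ) (hδ₀ : p.IsSyncEquilibrium δ₀)
    {m : Fin n → Fin n → ℝ} (hm : IsFaceBound p δ₀ m) {c : ℝ} (hcm : ∀ i j, p.b i j ≠ 0 → c < m i j)
    {y : (Fin n → ℝ) × (Fin n → ℝ)}
    (hy : y ∈ window p ∩ constraintSet p δ₀ ∧ phaseEnergy p δ₀ y ≤ c) :
    (∃ X : ℝ → (Fin n → ℝ) × (Fin n → ℝ), X 0 = y ∧
      ∀ T : ℝ, ∀ t ∈ Icc 0 T, HasDerivWithinAt X (phaseField p (X t)) (Icc 0 T) t) ∧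
    ∀ X : ℝ → (Fin n → ℝ) × (Fin n → ℝ), X 0 = y →
      (∀ T : ℝ, ∀ t ∈ Icc 0 T, HasDerivWithinAt X (phaseField p (X t)) (Icc 0 T) t) →
      (∀ t, 0 ≤ t → X t ∈ window p ∩ constraintSet p δ₀ ∧ phaseEnergy p δ₀ (X t) ≤ c) ∧
        Tendsto X atTop (𝓝 (δ₀, 0)) :=
  sublevel_subset_regionOfAttraction_of_isBelowFaces hp hn hconn hb hβ hβb hθ0 hθ h0 hδ₀
    (hm.isBelowFaces hp hcm) hy

/-- **The per-face theorem in the printed vocabulary (frame rotating at `ω₀`).** Under the data hypotheses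
of `sublevel_subset_regionOfAttraction_of_faceBound`, every solution `δ` of the shifted structure-preserving
model (model-2's `p.shifted.IsSolution`, all times) whose initial state has every coupled branch inside
`|δᵢ(0) − δⱼ(0)| < π/2`, momentum `L(δ(0), δ̇(0)) = L(δ₀, 0)` and energy `V(δ(0), δ̇(0)) ≤ c`, `c` below
the face bounds, keeps `V ≤ c` and the window for all `t ≥ 0`, and converges: `δ(t) → δ₀` and `δ̇ᵢ(t) → 0`
at every generator.  Mirrors lyap-1's `tendsto_of_isSolution`.  MODEL MV-3; no sentence here says a grid is
stable. [cite: BergenHill1981]; [cite: Padiyar2013, §3.2 eqs (3.2)–(3.5), Remark 2] -/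
theorem tendsto_of_isSolution_of_faceBound {p : Params n} (hp : p.WellFormed) (hn : n ≠ 0)
    (hconn : p.couplingGraph.Preconnected) (hb : ∀ i j, 0 ≤ p.b i j) {β : ℝ} (hβ : 0 < β)
    (hβb : ∀ i j, p.couplingGraph.Adj i j → β ≤ p.b i j)
    {δ₀ : Fin n → ℝ} {θ : ℝ} (hθ0 : 0 ≤ θ) (hθ : θ < π / 2)
    (h0 : ∀ i j, p.b i j ≠ 0 → |δ₀ i - δ₀ j| ≤ θ) (hδ₀ : p.IsSyncEquilibrium δ₀)
    {m : Fin n → Fin n → ℝ} (hm : IsFaceBound p δ₀ m) {c : ℝ} (hcm : ∀ i j, p.b i j ≠ 0 → c < m i j)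
    {δ : ℝ → Fin n → ℝ} (hδ : p.shifted.IsSolution δ)
    (hwin : ∀ i j, p.b i j ≠ 0 → |δ 0 i - δ 0 j| < π / 2)
    (hL : p.momentum (δ 0) (fun i => deriv (fun u => δ u i) 0) = p.momentum δ₀ 0)
    (hV : p.energy δ₀ (δ 0) (fun i => deriv (fun u => δ u i) 0) ≤ c) :
    (∀ t, 0 ≤ t → (∀ i j, p.b i j ≠ 0 → |δ t i - δ t j| < π / 2) ∧
        p.energy δ₀ (δ t) (fun i => deriv (fun u => δ u i) t) ≤ c) ∧
      Tendsto δ atTop (𝓝 δ₀) ∧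
      ∀ i ∈ p.gen, Tendsto (fun t => deriv (fun u => δ u i) t) atTop (𝓝 0) := by
  set X : ℝ → (Fin n → ℝ) × (Fin n → ℝ) :=
    fun s => (δ s, fun i => if i ∈ p.gen then deriv (fun u => δ u i) s else 0) with hX
  have hgen : ∀ s, ∀ i ∈ p.gen, (X s).2 i = deriv (fun u => δ u i) s := fun s i hi => by
    simp [hX, hi]
  have hXsol : ∀ T : ℝ, ∀ t ∈ Icc 0 T, HasDerivWithinAt X (phaseField p (X t)) (Icc 0 T) t :=
    fun T t _ => (hasDerivAt_phase_of_isSolution hp hδ t).hasDerivWithinAt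
  have hy : X 0 ∈ window p ∩ constraintSet p δ₀ ∧ phaseEnergy p δ₀ (X 0) ≤ c := by
    refine ⟨⟨hwin, ?_, fun i hi => by simp [hX, hi]⟩, ?_⟩
    · rw [momentum_congr_gen p (δ 0) (hgen 0)]
      exact hL
    · rw [phaseEnergy_apply, energy_congr_gen p δ₀ (δ 0) (hgen 0)]
      exact hV
  obtain ⟨-, hall⟩ := sublevel_subset_regionOfAttraction_of_faceBound hp hn hconn hb hβ hβb hθ0 hθ h0
    hδ₀ hm hcm hy
  obtain ⟨hstay, hlim⟩ := hall X rfl hXsol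
  refine ⟨fun t ht => ⟨(hstay t ht).1.1, ?_⟩, ?_, fun i hi => ?_⟩
  · rw [← energy_congr_gen p δ₀ (δ t) (hgen t)]
    exact (hstay t ht).2
  · have h := (continuous_fst.tendsto _).comp hlim
    simpa [hX, Function.comp_def] using h
  · have h := (((continuous_apply i).comp continuous_snd).tendsto _).comp hlim
    simpa [hX, hi, Function.comp_def] using h

end Summit.Ventures.GridStability.Lyapunov.StructurePreserving

end
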